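import Literature.NumberTheory.LFunctions.RiemannSiegelPhase
import Literature.NumberTheory.LFunctions.ZetaZerosProofs
import Literature.NumberTheory.DiophantineGeometry.NamedHypothesesProofs
import HarnessLib

/-!
# Turing's method: counting the zeros of `ζ` up to height `T` from data on the critical line

Every verification of the Riemann hypothesis up to a height `T` (Turing 1953, Lehman 1970,
Brent 1979, …, Platt 2017, Platt–Trudgian 2021) has the same architecture:

1. sign changes of Hardy's function `Z(t)` (`Literature.NumberTheory.LFunctions.hardyZ`) at sample points
   `0 ≤ t₀ < t₁ < ⋯ < tₙ ≤ T` exhibit `n` zeros of `ζ` *on* the critical line, `n ≤ N₀(T)`;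
2. **Turing's method**: an explicit bound `∫_T^{T+h} S(t) dt ≤ B` (Turing, Lehman, Trudgian),
   together with a few more zeros found just above `T`, gives the *upper* bound `N(T) ≤ n` for
   the number of all zeros `0 < Im ρ ≤ T` of `ζ` in the critical strip;
3. `N(T) ≤ n ≤ N₀(T) ≤ N(T)` forces every zero up to height `T` onto the line
   (`Literature.NumberTheory.DiophantineGeometry.RiemannHypothesisUpTo.of_zetaZeroCount_le_criticalZeroCount`, file
   `NamedHypothesesProofs.lean`).

This file proves steps 1–3 as theorems about the tree's objects
`N(T) = Literature.zetaZeroCount T`, `N₀(T) = Literature.criticalZeroCount T`, `θ = Literature.riemannSiegelTheta`,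
`Z = Literature.hardyZ` and `S = Literature.zetaArgS` (Backlund's form `S(T) := N(T) − θ(T)/π − 1`, which is
also Edwards' definition in §8.2), and records the published explicit bounds for `∫ S` as named
facts. What remains of a numerical verification such as Platt–Trudgian's
(`Literature.NumberTheory.DiophantineGeometry.zetaZeroCount_platt_trudgian`) is then exactly its data: the sample points and the
certified signs of `Z`.

## Main results (namespace `Literature`)

* `continuous_riemannSiegelTheta`, `continuous_hardyZ` (from `hasDerivAt_riemannSiegelTheta_holds`
  and the differentiability of `ζ` off `s = 1`).
* `zetaZeroCount_add_card_le`, `criticalZeroCount_add_card_le`: `m` distinct zeros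
  `ζ(1/2 + iγ) = 0` with `a < γ ≤ b` give `N(a) + m ≤ N(b)` and `N₀(a) + m ≤ N₀(b)`.
* `le_criticalZeroCount_of_sign_changes` (via the intermediate value theorem, private lemmas
  `exists_strictMono_zeros_of_sign_changes`, `exists_finset_zeros_of_sign_changes`): `n` sign
  changes of `Z` on `[0, T]` give `n ≤ N₀(T)` (a zero of `Z` is a zero of `ζ` on the line:
  `Literature.NumberTheory.LFunctions.hardyZ_eq_zero_iff_holds`, file `RiemannSiegelPhase.lean`).
* `turing_lehman_lower_bound` (**the Turing–Lehman inequality**, Edwards §8.2): for `0 ≤ T`,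
  `0 ≤ h` and distinct zeros `ζ(1/2 + iγⱼ) = 0`, `T < γⱼ ≤ T + h`,
  `h·N(T) + Σⱼ (T + h − γⱼ) − ∫_T^{T+h} (θ(t)/π + 1) dt ≤ ∫_T^{T+h} S(t) dt`.
* `zetaZeroCount_le_of_turing` (**Turing's method**): if moreover `∫_T^{T+h} S ≤ B` and
  `B + ∫_T^{T+h} (θ/π + 1) − Σⱼ (T + h − γⱼ) < h (n + 1)`, then `N(T) ≤ n`.
* `RiemannHypothesisUpTo.of_turing`: steps 1–3 assembled — sign-change data below `T`, sign-change
  data on `[T, T + h]`, a bound `∫_T^{T+h} S ≤ B` and one numerical inequality imply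
  `RiemannHypothesisUpTo T ∧ N(T) = n ∧ N₀(T) = n`; `RiemannHypothesisUpTo.of_turing_trudgian` is
  the same with Trudgian's 2011 bound plugged in (conditional only on that named fact).
* Named facts (explicit bounds for `|∫_{t₁}^{t₂} S(t) dt|`): `abs_integral_zetaArgS_le_turing`
  (Turing 1953/Lehman 1970 as printed in Edwards §8.2 (1)), `abs_integral_zetaArgS_le_trudgian`
  (Trudgian 2011, Thm. 2.2), `abs_integral_zetaArgS_le_trudgianII` (Trudgian 2016, Thm. 1); the
  last two are the two references Platt–Trudgian 2021, §2 cite for Turing's method.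
* `tendsto_zetaZeroCount_atTop_of_infinite`: if `ζ` has infinitely many zeros on the critical
  line (Hardy 1914; the named fact `Literature.NumberTheory.LFunctions.hardy_infinite_zeros_on_critical_line`, taken as a
  hypothesis), then `N(T) → ∞` (the named fact `Literature.NumberTheory.LFunctions.tendsto_zetaZeroCount_atTop`).

## On conventions for `S(t)`

The sources define `S(t) = π⁻¹ arg ζ(1/2 + it)` by continuous variation along `2 → 2 + it →
1/2 + it` (with an averaged value at ordinates of zeros), whereas `Literature.NumberTheory.LFunctions.zetaArgS` is Backlund's
`N(t) − θ(t)/π − 1` with the right-continuous `N`. By the exact Riemann–von Mangoldt–Backlund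
formula `N(t) = θ(t)/π + 1 + π⁻¹ arg ζ(1/2 + it)` for `t` not an ordinate (Titchmarsh §9.3,
eq. (9.3.2); Edwards §6.6–6.7) the two functions agree off the countable set of ordinates, so all
statements about `∫ S` are literally the same for both. Gram points, Gram blocks and Rosser's rule
(the Lehman–Brent criterion, Trudgian 2011 Thm. 2.1) are not needed and not formalised: the
integral form above is the one that applies to rigorously isolated zeros (cf. Platt 2017;
Platt–Trudgian 2021, §2), and a slip in the Gram-block constants of Lehman–Brent has been reported
(Amberger 2025, arXiv:2512.23064, §1).

## References

* A. M. Turing, *Some calculations of the Riemann zeta-function*, Proc. LMS (3) 3 (1953) 99–117.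
* R. S. Lehman, *On the distribution of zeros of the Riemann zeta-function*, Proc. LMS (3) 20
  (1970) 303–320.
* H. M. Edwards, *Riemann's Zeta Function* (1974), §6.6–6.7, §8.2 (Turing's method).
* T. S. Trudgian, *Improvements to Turing's method*, Math. Comp. 80 (2011) 2259–2279, Thm. 2.2.
* T. S. Trudgian, *Improvements to Turing's method II*, Rocky Mountain J. Math. 46 (2016)
  325–332, Thm. 1.
* D. J. Platt, *Isolating some non-trivial zeros of zeta*, Math. Comp. 86 (2017) 2449–2467.
* D. J. Platt, T. S. Trudgian, *The Riemann hypothesis is true up to `3·10¹²`*, Bull. LMS 53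
  (2021) 792–797, §2.
* E. C. Titchmarsh, *The Theory of the Riemann Zeta-Function*, 2nd ed. (1986), §9.3.
-/

noncomputable section

open Complex Set MeasureTheory intervalIntegral
open scoped Real

namespace Literature.NumberTheory.LFunctions

/-! ### Continuity of `θ` and `Z` -/

/-- The Riemann–Siegel theta function is continuous (it is differentiable,
`hasDerivAt_riemannSiegelTheta_holds`). [folklore] -/
theorem continuous_riemannSiegelTheta : Continuous riemannSiegelTheta :=
  continuous_iff_continuousAt.2 fun t ↦ (hasDerivAt_riemannSiegelTheta_holds t).continuousAt

/-- Hardy's function `Z` is continuous on `ℝ` (`θ` is differentiable and `ζ` is holomorphic away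
from `s = 1`, which is not on the critical line). [folklore] -/
theorem continuous_hardyZ : Continuous hardyZ := by
  have h1 : Continuous fun t : ℝ ↦ cexp ((riemannSiegelTheta t : ℂ) * I) :=
    Complex.continuous_exp.comp
      ((Complex.continuous_ofReal.comp continuous_riemannSiegelTheta).mul continuous_const)
  -- continuity of `t ↦ ζ(1/2 + it)`; also available as `Literature.NumberTheory.LFunctions.continuous_riemannZeta_line`
  -- (NymanBeurlingDirichlet.lean), not imported here to keep this counting file light.
  have h2 : Continuous fun t : ℝ ↦ riemannZeta (1 / 2 + t * I) := by
    refine continuous_iff_continuousAt.2 fun t ↦ ?_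
    have hne : (1 / 2 + (t : ℂ) * I) ≠ 1 := by
      intro h
      have := congrArg Complex.re h
      norm_num at this
    exact ContinuousAt.comp (g := riemannZeta) (f := fun t : ℝ ↦ (1 / 2 : ℂ) + (t : ℂ) * I)
      (differentiableAt_riemannZeta hne).continuousAt (by fun_prop)
  exact Complex.continuous_re.comp (h1.mul h2)

/-! ### Counting found zeros -/

/-- Abstract counting step: if `A ⊆ B` are sets of points of positive multiplicity, `B` finite,
and `Z` is a finite set of points of `B` outside `A`, then `Σ_A m + |Z| ≤ Σ_B m`. [folklore] -/
theorem finsum_riemannZetaZeroOrder_add_card_le {A B : Set ℂ} (hB : B.Finite) (hAB : A ⊆ B)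
    (hpos : ∀ ρ ∈ B, 0 < riemannZetaZeroOrder ρ) (Z : Finset ℂ) (hZ : ↑Z ⊆ B \ A) :
    ∑ᶠ ρ ∈ A, riemannZetaZeroOrder ρ + Z.card ≤ ∑ᶠ ρ ∈ B, riemannZetaZeroOrder ρ := by
  have hA : A.Finite := hB.subset hAB
  rw [finsum_mem_eq_finite_toFinset_sum _ hA, finsum_mem_eq_finite_toFinset_sum _ hB]
  have hdisj : Disjoint hA.toFinset Z := by
    rw [Finset.disjoint_left]
    intro ρ hρA hρZ
    exact (hZ hρZ).2 ((Set.Finite.mem_toFinset hA).1 hρA)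
  have hsub : hA.toFinset ∪ Z ⊆ hB.toFinset := by
    intro ρ hρ
    rw [Finset.mem_union] at hρ
    rw [Set.Finite.mem_toFinset]
    rcases hρ with h | h
    · exact hAB ((Set.Finite.mem_toFinset hA).1 h)
    · exact (hZ h).1
  have hcard : (Z.card : ℤ) ≤ ∑ ρ ∈ Z, riemannZetaZeroOrder ρ := by
    have : ∑ _ρ ∈ Z, (1 : ℤ) ≤ ∑ ρ ∈ Z, riemannZetaZeroOrder ρ :=
      Finset.sum_le_sum fun ρ hρ ↦ hpos ρ (hZ hρ).1
    simpa using this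
  calc ∑ ρ ∈ hA.toFinset, riemannZetaZeroOrder ρ + (Z.card : ℤ)
      ≤ ∑ ρ ∈ hA.toFinset, riemannZetaZeroOrder ρ + ∑ ρ ∈ Z, riemannZetaZeroOrder ρ := by
        gcongr
    _ = ∑ ρ ∈ hA.toFinset ∪ Z, riemannZetaZeroOrder ρ := (Finset.sum_union hdisj).symm
    _ ≤ ∑ ρ ∈ hB.toFinset, riemannZetaZeroOrder ρ := by
        refine Finset.sum_le_sum_of_subset_of_nonneg hsub fun ρ hρ _ ↦ ?_
        exact (hpos ρ ((Set.Finite.mem_toFinset hB).1 hρ)).le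

/-- The point `1/2 + iγ` of the critical line has real part `1/2`. [folklore] -/
private theorem re_half_add_mul_I (γ : ℝ) : ((1 / 2 : ℂ) + γ * I).re = 1 / 2 := by simp

/-- The point `1/2 + iγ` of the critical line has imaginary part `γ`. [folklore] -/
private theorem im_half_add_mul_I (γ : ℝ) : ((1 / 2 : ℂ) + γ * I).im = γ := by simp

/-- **Found zeros raise `N`.** If `Z` is a finite set of reals `γ ∈ (a, b]` (`0 ≤ a ≤ b`) with
`ζ(1/2 + iγ) = 0`, then `N(a) + |Z| ≤ N(b)`. [folklore] -/
theorem zetaZeroCount_add_card_le {a b : ℝ} (ha : 0 ≤ a) (hab : a ≤ b) (Z : Finset ℝ)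
    (hZ : ∀ γ ∈ Z, riemannZeta (1 / 2 + γ * I) = 0 ∧ a < γ ∧ γ ≤ b) :
    zetaZeroCount a + Z.card ≤ zetaZeroCount b := by
  classical
  set e : ℝ → ℂ := fun γ ↦ 1 / 2 + γ * I with he
  have heinj : Function.Injective e := by
    intro x y hxy
    have := congrArg Complex.im hxy
    simpa [he] using this
  have hsub : zetaZeroBox 0 a ⊆ zetaZeroBox 0 b := by
    rintro ρ ⟨h0, h1, h2, h3, h4⟩
    exact ⟨h0, h1, h2, h3, h4.trans hab⟩
  have hZ' : ↑(Z.image e) ⊆ zetaZeroBox 0 b \ zetaZeroBox 0 a := by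
    intro ρ hρ
    rw [Finset.coe_image] at hρ
    obtain ⟨γ, hγ, rfl⟩ := hρ
    obtain ⟨hz, haγ, hγb⟩ := hZ γ hγ
    refine ⟨⟨hz, ?_, ?_, ?_, ?_⟩, ?_⟩
    · rw [re_half_add_mul_I]; norm_num
    · rw [re_half_add_mul_I]; norm_num
    · rw [im_half_add_mul_I]; linarith
    · rw [im_half_add_mul_I]; exact hγb
    · rintro ⟨-, -, -, -, h4⟩
      rw [im_half_add_mul_I] at h4
      linarith
  have key := finsum_riemannZetaZeroOrder_add_card_le (zetaZeroBox_finite 0 b) hsub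
    (fun ρ hρ ↦ DiophantineGeometry.riemannZetaZeroOrder_pos_of_mem_zetaZeroBox hρ) (Z.image e) hZ'
  rw [Finset.card_image_of_injective _ heinj] at key
  have hAnonneg : 0 ≤ ∑ᶠ ρ ∈ zetaZeroBox 0 a, riemannZetaZeroOrder ρ :=
    finsum_nonneg fun ρ ↦ finsum_nonneg fun hρ ↦
      (DiophantineGeometry.riemannZetaZeroOrder_pos_of_mem_zetaZeroBox hρ).le
  unfold zetaZeroCount zetaZeroCountRe
  omega

/-- **Found zeros on the line raise `N₀`.** If `Z` is a finite set of reals `γ ∈ (a, b]`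
(`0 ≤ a ≤ b`) with `ζ(1/2 + iγ) = 0`, then `N₀(a) + |Z| ≤ N₀(b)`. [folklore] -/
theorem criticalZeroCount_add_card_le {a b : ℝ} (ha : 0 ≤ a) (hab : a ≤ b) (Z : Finset ℝ)
    (hZ : ∀ γ ∈ Z, riemannZeta (1 / 2 + γ * I) = 0 ∧ a < γ ∧ γ ≤ b) :
    criticalZeroCount a + Z.card ≤ criticalZeroCount b := by
  classical
  set e : ℝ → ℂ := fun γ ↦ 1 / 2 + γ * I with he
  have heinj : Function.Injective e := by
    intro x y hxy
    have := congrArg Complex.im hxy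
    simpa [he] using this
  set C : ℝ → Set ℂ := fun T ↦ {ρ ∈ zetaZeroBox (1 / 2) T | ρ.re = 1 / 2} with hC
  have hsub : C a ⊆ C b := by
    rintro ρ ⟨⟨h0, h1, h2, h3, h4⟩, h5⟩
    exact ⟨⟨h0, h1, h2, h3, h4.trans hab⟩, h5⟩
  have hCb : (C b).Finite := (zetaZeroBox_finite _ _).subset (sep_subset _ _)
  have hposb : ∀ ρ ∈ C b, 0 < riemannZetaZeroOrder ρ := fun ρ hρ ↦
    DiophantineGeometry.riemannZetaZeroOrder_pos_of_mem_zetaZeroBox (DiophantineGeometry.criticalZeroSet_subset_zetaZeroBox b hρ)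
  have hZ' : ↑(Z.image e) ⊆ C b \ C a := by
    intro ρ hρ
    rw [Finset.coe_image] at hρ
    obtain ⟨γ, hγ, rfl⟩ := hρ
    obtain ⟨hz, haγ, hγb⟩ := hZ γ hγ
    refine ⟨⟨⟨hz, ?_, ?_, ?_, ?_⟩, re_half_add_mul_I γ⟩, ?_⟩
    · rw [re_half_add_mul_I]
    · rw [re_half_add_mul_I]; norm_num
    · rw [im_half_add_mul_I]; linarith
    · rw [im_half_add_mul_I]; exact hγb
    · rintro ⟨⟨-, -, -, -, h4⟩, -⟩
      rw [im_half_add_mul_I] at h4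
      linarith
  have key := finsum_riemannZetaZeroOrder_add_card_le hCb hsub hposb (Z.image e) hZ'
  rw [Finset.card_image_of_injective _ heinj] at key
  have hAnonneg : 0 ≤ ∑ᶠ ρ ∈ C a, riemannZetaZeroOrder ρ :=
    finsum_nonneg fun ρ ↦ finsum_nonneg fun hρ ↦
      (DiophantineGeometry.riemannZetaZeroOrder_pos_of_mem_zetaZeroBox (DiophantineGeometry.criticalZeroSet_subset_zetaZeroBox a hρ)).le
  unfold criticalZeroCount
  simp only [hC] at key hAnonneg
  omega

/-! ### Sign changes -/

/-- **Sign changes locate zeros (IVT), indexed form.** If a continuous `f : ℝ → ℝ` has strict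
sign changes `f(t_i) f(t_{i+1}) < 0` along points `t_0 < t_1 < ⋯ < t_k`, then there are zeros
`c_0 < c_1 < ⋯ < c_{k-1}` of `f` with `t_i < c_i < t_{i+1}`. [folklore] -/
private theorem exists_strictMono_zeros_of_sign_changes {f : ℝ → ℝ} (hf : Continuous f) {k : ℕ}
    (t : Fin (k + 1) → ℝ) (ht : StrictMono t)
    (hsign : ∀ i : Fin k, f (t i.castSucc) * f (t i.succ) < 0) :
    ∃ c : Fin k → ℝ, StrictMono c ∧ ∀ i, f (c i) = 0 ∧ t i.castSucc < c i ∧ c i < t i.succ := by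
  have hzero : ∀ i : Fin k, ∃ c, f c = 0 ∧ t i.castSucc < c ∧ c < t i.succ := by
    intro i
    have hlt : t i.castSucc < t i.succ := ht Fin.castSucc_lt_succ
    have h0 : (0 : ℝ) ∈ uIcc (f (t i.castSucc)) (f (t i.succ)) := by
      rcases mul_neg_iff.1 (hsign i) with ⟨h1, h2⟩ | ⟨h1, h2⟩
      · exact mem_uIcc.2 (Or.inr ⟨h2.le, h1.le⟩)
      · exact mem_uIcc.2 (Or.inl ⟨h1.le, h2.le⟩)
    obtain ⟨c, hc, hfc⟩ := intermediate_value_uIcc hf.continuousOn h0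
    rw [uIcc_of_le hlt.le] at hc
    have hne1 : c ≠ t i.castSucc := by
      rintro rfl
      exact (mul_neg_iff.1 (hsign i)).elim (fun h ↦ h.1.ne' hfc) (fun h ↦ h.1.ne hfc)
    have hne2 : c ≠ t i.succ := by
      rintro rfl
      exact (mul_neg_iff.1 (hsign i)).elim (fun h ↦ h.2.ne hfc) (fun h ↦ h.2.ne' hfc)
    exact ⟨c, hfc, lt_of_le_of_ne hc.1 hne1.symm, lt_of_le_of_ne hc.2 hne2⟩
  choose c hc using hzero
  refine ⟨c, ?_, hc⟩
  intro i j hij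
  calc c i < t i.succ := (hc i).2.2
    _ ≤ t j.castSucc := ht.monotone (by
        rw [Fin.le_iff_val_le_val, Fin.val_succ, Fin.val_castSucc]; exact hij)
    _ < c j := (hc j).2.1

/-- **Sign changes locate zeros (IVT).** If a continuous `f : ℝ → ℝ` has strict sign changes
`f(t_i) f(t_{i+1}) < 0` along points `t_0 < t_1 < ⋯ < t_k`, then there is a set of `k` distinct
zeros of `f` in the open interval `(t_0, t_k)`. [folklore] -/
private theorem exists_finset_zeros_of_sign_changes {f : ℝ → ℝ} (hf : Continuous f) {k : ℕ}
    (t : Fin (k + 1) → ℝ) (ht : StrictMono t)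
    (hsign : ∀ i : Fin k, f (t i.castSucc) * f (t i.succ) < 0) :
    ∃ Z : Finset ℝ, Z.card = k ∧ ∀ c ∈ Z, f c = 0 ∧ t 0 < c ∧ c < t (Fin.last k) := by
  classical
  obtain ⟨c, hcmono, hc⟩ := exists_strictMono_zeros_of_sign_changes hf t ht hsign
  refine ⟨Finset.univ.image c, ?_, ?_⟩
  · rw [Finset.card_image_of_injective _ hcmono.injective, Finset.card_univ, Fintype.card_fin]
  · intro x hx
    rw [Finset.mem_image] at hx
    obtain ⟨i, -, rfl⟩ := hx
    refine ⟨(hc i).1, ?_, ?_⟩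
    · exact lt_of_le_of_lt (ht.monotone (Fin.zero_le _)) (hc i).2.1
    · exact lt_of_lt_of_le (hc i).2.2 (ht.monotone (Fin.le_last _))

/-- **Step 1 of a verification: sign changes of `Z` bound `N₀` from below.** If Hardy's function
has `k` strict sign changes along sample points `0 ≤ t_0 < ⋯ < t_k ≤ T`, then `k ≤ N₀(T)`: each
sign change is a zero of `Z`, i.e. (`Literature.NumberTheory.LFunctions.hardyZ_eq_zero_iff_holds`) a zero of `ζ` on the critical
line. (Edwards §8.3; Platt–Trudgian 2021, §2.)
[cite: EdwardsZeta1974, §8.2–8.3] -/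
theorem le_criticalZeroCount_of_sign_changes {T : ℝ} {k : ℕ}
    (t : Fin (k + 1) → ℝ) (ht : StrictMono t) (h0 : 0 ≤ t 0) (hT : t (Fin.last k) ≤ T)
    (hsign : ∀ i : Fin k, hardyZ (t i.castSucc) * hardyZ (t i.succ) < 0) :
    k ≤ criticalZeroCount T := by
  obtain ⟨Z, hcard, hZ⟩ := exists_finset_zeros_of_sign_changes continuous_hardyZ t ht hsign
  have h0T : 0 ≤ T := h0.trans ((ht.monotone (Fin.zero_le _)).trans hT)
  have h := criticalZeroCount_add_card_le le_rfl h0T Z fun γ hγ ↦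
    ⟨(hardyZ_eq_zero_iff_holds γ).1 (hZ γ hγ).1, h0.trans_lt (hZ γ hγ).2.1,
      (hZ γ hγ).2.2.le.trans hT⟩
  rwa [criticalZeroCount_eq_zero_of_nonpos le_rfl, zero_add, hcard] at h

/-! ### Integrability of `N`, `θ`, `S` on bounded intervals -/

/-- `N(t)` is interval integrable (it is monotone). [folklore] -/
theorem intervalIntegrable_zetaZeroCount (a b : ℝ) :
    IntervalIntegrable (fun t ↦ (zetaZeroCount t : ℝ)) volume a b :=
  Monotone.intervalIntegrable fun _ _ hxy ↦ by exact_mod_cast zetaZeroCount_mono hxy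

/-- `θ` is interval integrable (it is continuous). [folklore] -/
theorem intervalIntegrable_riemannSiegelTheta (a b : ℝ) :
    IntervalIntegrable riemannSiegelTheta volume a b :=
  continuous_riemannSiegelTheta.intervalIntegrable a b

/-- `S(t) = N(t) − θ(t)/π − 1` is interval integrable. [folklore] -/
theorem intervalIntegrable_zetaArgS (a b : ℝ) : IntervalIntegrable zetaArgS volume a b := by
  have h := ((intervalIntegrable_zetaZeroCount a b).sub
    ((intervalIntegrable_riemannSiegelTheta a b).div_const π)).sub
    (intervalIntegrable_const (μ := volume) (a := a) (b := b) (c := (1 : ℝ)))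
  have e : zetaArgS = fun T ↦ (zetaZeroCount T : ℝ) - riemannSiegelTheta T / π - 1 := rfl
  rw [e]
  exact h

/-! ### The counting function of a finite set of found zeros -/

/-- The step `t ↦ [γ < t]` is monotone. [folklore] -/
private theorem monotone_ite_lt (γ : ℝ) : Monotone fun t : ℝ ↦ if γ < t then (1 : ℝ) else 0 := by
  intro x y hxy
  by_cases hx : γ < x
  · have hy : γ < y := hx.trans_le hxy
    simp [hx, hy]
  · by_cases hy : γ < y <;> simp [hx, hy]

/-- `∫_a^b [γ < t] dt = b − γ` for `a ≤ γ ≤ b`. [folklore] -/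
private theorem integral_ite_lt {a b γ : ℝ} (ha : a ≤ γ) (hb : γ ≤ b) :
    ∫ t in a..b, (if γ < t then (1 : ℝ) else 0) = b - γ := by
  have hi : ∀ c d, IntervalIntegrable (fun t : ℝ ↦ if γ < t then (1 : ℝ) else 0) volume c d :=
    fun c d ↦ (monotone_ite_lt γ).intervalIntegrable
  rw [← intervalIntegral.integral_add_adjacent_intervals (hi a γ) (hi γ b)]
  have h1 : ∫ t in a..γ, (if γ < t then (1 : ℝ) else 0) = ∫ _ in a..γ, (0 : ℝ) := by
    refine intervalIntegral.integral_congr fun t ht ↦ ?_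
    rw [uIcc_of_le ha] at ht
    simp [not_lt.2 ht.2]
  have h2 : ∫ t in γ..b, (if γ < t then (1 : ℝ) else 0) = ∫ _ in γ..b, (1 : ℝ) := by
    refine intervalIntegral.integral_congr_ae (Filter.Eventually.of_forall fun t ht ↦ ?_)
    rw [uIoc_of_le hb] at ht
    simp [ht.1]
  rw [h1, h2]
  simp

/-- The number of found zeros below `t`, `#{γ ∈ Z | γ < t}`, integrates over `[T, T + h]` to
`Σ_{γ ∈ Z} (T + h − γ)` when all `γ ∈ (T, T + h]`. [folklore] -/
theorem integral_card_filter_lt {T h : ℝ} (Z : Finset ℝ) (hZ : ∀ γ ∈ Z, T < γ ∧ γ ≤ T + h) :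
    ∫ t in T..T + h, ((Z.filter (· < t)).card : ℝ) = ∑ γ ∈ Z, (T + h - γ) := by
  simp_rw [Finset.natCast_card_filter]
  rw [intervalIntegral.integral_finsetSum fun γ _ ↦ (monotone_ite_lt γ).intervalIntegrable]
  exact Finset.sum_congr rfl fun γ hγ ↦ integral_ite_lt (hZ γ hγ).1.le (hZ γ hγ).2

/-- The counting function `t ↦ #{γ ∈ Z | γ < t}` is monotone. [folklore] -/
theorem monotone_card_filter_lt (Z : Finset ℝ) :
    Monotone fun t : ℝ ↦ ((Z.filter (· < t)).card : ℝ) := by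
  intro x y hxy
  have hsub : Z.filter (· < x) ⊆ Z.filter (· < y) := fun γ hγ ↦ by
    rw [Finset.mem_filter] at hγ ⊢
    exact ⟨hγ.1, hγ.2.trans_le hxy⟩
  have h := Finset.card_le_card hsub
  dsimp only
  exact_mod_cast h

/-- Pointwise: `N(T) + #{γ ∈ Z | γ < t} ≤ N(t)` for `0 ≤ T ≤ t`, when `Z` consists of ordinates
`γ > T` of zeros of `ζ` on the critical line. [folklore] -/
theorem zetaZeroCount_add_card_filter_lt_le {T t : ℝ} (hT : 0 ≤ T) (hTt : T ≤ t) (Z : Finset ℝ)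
    (hZ : ∀ γ ∈ Z, riemannZeta (1 / 2 + γ * I) = 0 ∧ T < γ) :
    (zetaZeroCount T : ℝ) + ((Z.filter (· < t)).card : ℝ) ≤ zetaZeroCount t := by
  have h := zetaZeroCount_add_card_le hT hTt (Z.filter (· < t)) fun γ hγ ↦ by
    rw [Finset.mem_filter] at hγ
    exact ⟨(hZ γ hγ.1).1, (hZ γ hγ.1).2, hγ.2.le⟩
  exact_mod_cast h

/-! ### The Turing–Lehman inequality and Turing's method -/

/-- **The Turing–Lehman inequality** (Edwards §8.2, the display before (2); Lehman 1970).
Let `0 ≤ T`, `0 ≤ h`, and let `Z` be a finite set of ordinates `γ ∈ (T, T + h]` of zeros of `ζ`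
on the critical line ("found zeros"). Since `N(t) ≥ N(T) + #{γ ∈ Z | γ < t}` on `[T, T + h]`
and `S = N − θ/π − 1`,
`h · N(T) + Σ_{γ ∈ Z} (T + h − γ) − ∫_T^{T+h} (θ(t)/π + 1) dt ≤ ∫_T^{T+h} S(t) dt`.
[cite: EdwardsZeta1974, §8.2] -/
theorem turing_lehman_lower_bound {T h : ℝ} (hT : 0 ≤ T) (hh : 0 ≤ h) (Z : Finset ℝ)
    (hZ : ∀ γ ∈ Z, riemannZeta (1 / 2 + γ * I) = 0 ∧ T < γ ∧ γ ≤ T + h) :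
    h * zetaZeroCount T + ∑ γ ∈ Z, (T + h - γ)
        - ∫ t in T..T + h, (riemannSiegelTheta t / π + 1)
      ≤ ∫ t in T..T + h, zetaArgS t := by
  set F : ℝ → ℝ := fun t ↦ ((Z.filter (· < t)).card : ℝ) with hF
  have hFi : IntervalIntegrable F volume T (T + h) := (monotone_card_filter_lt Z).intervalIntegrable
  have hθi : IntervalIntegrable (fun t ↦ riemannSiegelTheta t / π + 1) volume T (T + h) :=
    ((intervalIntegrable_riemannSiegelTheta T (T + h)).div_const π).add
      (intervalIntegrable_const (c := (1 : ℝ)))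
  have hci : IntervalIntegrable (fun _ ↦ (zetaZeroCount T : ℝ)) volume T (T + h) :=
    intervalIntegrable_const
  have hfi : IntervalIntegrable
      (fun t ↦ (zetaZeroCount T : ℝ) + F t - (riemannSiegelTheta t / π + 1)) volume T (T + h) :=
    (hci.add hFi).sub hθi
  have hmono : ∫ t in T..T + h, ((zetaZeroCount T : ℝ) + F t - (riemannSiegelTheta t / π + 1))
      ≤ ∫ t in T..T + h, zetaArgS t := by
    refine intervalIntegral.integral_mono_on (by linarith) hfi (intervalIntegrable_zetaArgS _ _)
      fun t ht ↦ ?_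
    have := zetaZeroCount_add_card_filter_lt_le hT ht.1 Z fun γ hγ ↦ ⟨(hZ γ hγ).1, (hZ γ hγ).2.1⟩
    simp only [zetaArgS, hF]
    linarith
  have hcalc : ∫ t in T..T + h, ((zetaZeroCount T : ℝ) + F t - (riemannSiegelTheta t / π + 1))
      = h * zetaZeroCount T + ∑ γ ∈ Z, (T + h - γ)
        - ∫ t in T..T + h, (riemannSiegelTheta t / π + 1) := by
    rw [intervalIntegral.integral_sub (hci.add hFi) hθi, intervalIntegral.integral_add hci hFi,
      intervalIntegral.integral_const, hF, integral_card_filter_lt Z fun γ hγ ↦ (hZ γ hγ).2]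
    simp only [smul_eq_mul]
    ring
  linarith [hmono, hcalc]

/-- **Turing's method** (integral form of Turing 1953 / Lehman 1970, as in Edwards §8.2, (2);
the form used with rigorously isolated zeros, cf. Platt 2017, Platt–Trudgian 2021 §2). Let
`0 ≤ T`, `0 ≤ h`, let `Z` be a finite set of ordinates `γ ∈ (T, T + h]` of zeros of `ζ` on the
critical line, and suppose `∫_T^{T+h} S(t) dt ≤ B`. If
`B + ∫_T^{T+h} (θ(t)/π + 1) dt − Σ_{γ ∈ Z} (T + h − γ) < h (n + 1)`, then `N(T) ≤ n`.
[cite: EdwardsZeta1974, §8.2] -/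
theorem zetaZeroCount_le_of_turing {T h B : ℝ} {n : ℕ} (hT : 0 ≤ T) (hh : 0 ≤ h)
    (Z : Finset ℝ) (hZ : ∀ γ ∈ Z, riemannZeta (1 / 2 + γ * I) = 0 ∧ T < γ ∧ γ ≤ T + h)
    (hS : ∫ t in T..T + h, zetaArgS t ≤ B)
    (hnum : B + (∫ t in T..T + h, (riemannSiegelTheta t / π + 1)) - ∑ γ ∈ Z, (T + h - γ)
        < h * (n + 1)) :
    zetaZeroCount T ≤ n := by
  by_contra hlt
  rw [not_le] at hlt
  have h1 : (n : ℝ) + 1 ≤ zetaZeroCount T := by exact_mod_cast Nat.succ_le_of_lt hlt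
  have h2 : h * ((n : ℝ) + 1) ≤ h * zetaZeroCount T := mul_le_mul_of_nonneg_left h1 hh
  have h3 := turing_lehman_lower_bound hT hh Z hZ
  linarith

/-- Found zeros above `T` from sign changes: if `Z` has strict sign changes along
`T ≤ s_0 < s_1 < ⋯ < s_m ≤ T + h`, there is a set of `m` ordinates `γ_j ∈ (s_j, s_{j+1})` of
zeros of `ζ` on the critical line, and `Σ_j (T + h − s_{j+1}) ≤ Σ_{γ} (T + h − γ)`.
(A zero of `Z` is a zero of `ζ` on the line: `Literature.NumberTheory.LFunctions.hardyZ_eq_zero_iff_holds`.) [folklore] -/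
theorem exists_finset_zeros_above_of_sign_changes {T h : ℝ} {m : ℕ}
    (s : Fin (m + 1) → ℝ) (hs : StrictMono s) (hs0 : T ≤ s 0) (hsm : s (Fin.last m) ≤ T + h)
    (hsign : ∀ i : Fin m, hardyZ (s i.castSucc) * hardyZ (s i.succ) < 0) :
    ∃ Z : Finset ℝ, (∀ γ ∈ Z, riemannZeta (1 / 2 + γ * I) = 0 ∧ T < γ ∧ γ ≤ T + h) ∧
      ∑ i : Fin m, (T + h - s i.succ) ≤ ∑ γ ∈ Z, (T + h - γ) := by
  classical
  obtain ⟨c, hcmono, hc⟩ := exists_strictMono_zeros_of_sign_changes continuous_hardyZ s hs hsign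
  refine ⟨Finset.univ.image c, ?_, ?_⟩
  · intro γ hγ
    rw [Finset.mem_image] at hγ
    obtain ⟨i, -, rfl⟩ := hγ
    refine ⟨(hardyZ_eq_zero_iff_holds _).1 (hc i).1, ?_, ?_⟩
    · exact hs0.trans_lt ((hs.monotone (Fin.zero_le _)).trans_lt (hc i).2.1)
    · exact ((hc i).2.2.le.trans (hs.monotone (Fin.le_last _))).trans hsm
  · rw [Finset.sum_image fun i _ j _ hij ↦ hcmono.injective hij]
    exact Finset.sum_le_sum fun i _ ↦ by linarith [(hc i).2.2]

/-- **A complete verification step (Turing's method assembled).** Data: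
(i) `n` strict sign changes of `Z` along `0 ≤ t_0 < ⋯ < t_n ≤ T`;
(ii) `m` strict sign changes of `Z` along `T ≤ s_0 < ⋯ < s_m ≤ T + h` (`0 ≤ h`);
(iii) a bound `∫_T^{T+h} S(t) dt ≤ B` (e.g. from `abs_integral_zetaArgS_le_trudgian`);
(iv) the inequality `B + ∫_T^{T+h} (θ(t)/π + 1) dt − Σ_{j<m} (T + h − s_{j+1}) < h (n + 1)`.
Conclusion: `N(T) = N₀(T) = n` and the Riemann hypothesis holds up to height `T`.
(Edwards §8.2–8.3; Platt–Trudgian 2021 §2.)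
[cite: EdwardsZeta1974, §8.2] -/
theorem _root_.Literature.NumberTheory.DiophantineGeometry.RiemannHypothesisUpTo.of_turing {T h B : ℝ} {n m : ℕ}
    (hh : 0 ≤ h)
    (t : Fin (n + 1) → ℝ) (ht : StrictMono t) (ht0 : 0 ≤ t 0) (htn : t (Fin.last n) ≤ T)
    (htsign : ∀ i : Fin n, hardyZ (t i.castSucc) * hardyZ (t i.succ) < 0)
    (s : Fin (m + 1) → ℝ) (hs : StrictMono s) (hs0 : T ≤ s 0) (hsm : s (Fin.last m) ≤ T + h)
    (hssign : ∀ i : Fin m, hardyZ (s i.castSucc) * hardyZ (s i.succ) < 0)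
    (hS : ∫ t in T..T + h, zetaArgS t ≤ B)
    (hnum : B + (∫ t in T..T + h, (riemannSiegelTheta t / π + 1)) - ∑ i : Fin m, (T + h - s i.succ)
        < h * (n + 1)) :
    DiophantineGeometry.RiemannHypothesisUpTo T ∧ zetaZeroCount T = n ∧ criticalZeroCount T = n := by
  have hT : 0 ≤ T := ht0.trans ((ht.monotone (Fin.zero_le _)).trans htn)
  obtain ⟨Z, hZ, hsum⟩ := exists_finset_zeros_above_of_sign_changes s hs hs0 hsm hssign
  have hup : zetaZeroCount T ≤ n :=
    zetaZeroCount_le_of_turing hT hh Z hZ hS (by linarith)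
  have hlow : n ≤ criticalZeroCount T :=
    le_criticalZeroCount_of_sign_changes t ht ht0 htn htsign
  have hle : criticalZeroCount T ≤ zetaZeroCount T := DiophantineGeometry.criticalZeroCount_le T
  exact ⟨DiophantineGeometry.RiemannHypothesisUpTo.of_zetaZeroCount_le_criticalZeroCount (by omega), by omega,
    by omega⟩

/-! ### Explicit bounds for `∫ S(t) dt` (named facts) -/

/-- **Turing's bound for `∫ S`** (Turing 1953, with the corrections of Lehman 1970), as printed
in Edwards §8.2, (1): for `168π < t₁ < t₂`,
`|∫_{t₁}^{t₂} S(t) dt| ≤ 2.30 + 0.128 log (t₂ / 2π)`.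
Here `S = Literature.zetaArgS = N − θ/π − 1` is exactly Edwards' definition (§8.2); it agrees with
`π⁻¹ arg ζ(1/2 + it)` off the ordinates of zeros (Titchmarsh (9.3.2)), so the integral is the
sources'. [cite: EdwardsZeta1974, §8.2 (1)] -/
def abs_integral_zetaArgS_le_turing : Prop :=
  ∀ ⦃t₁ t₂ : ℝ⦄, 168 * π < t₁ → t₁ < t₂ →
    |∫ t in t₁..t₂, zetaArgS t| ≤ 2.30 + 0.128 * Real.log (t₂ / (2 * π))

/-- **Trudgian 2011, Theorem 2.2** (*Improvements to Turing's method*, Math. Comp. 80):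
if `t₂ > t₁ > 168π` then `|∫_{t₁}^{t₂} S(t) dt| ≤ 2.067 + 0.059 log t₂`.
(`S = Literature.zetaArgS`; see `abs_integral_zetaArgS_le_turing` for the convention. This is the first
of the two references Platt–Trudgian 2021, §2 cite for Turing's method.)
[cite: Trudgian2011, Thm. 2.2] -/
def abs_integral_zetaArgS_le_trudgian : Prop :=
  ∀ ⦃t₁ t₂ : ℝ⦄, 168 * π < t₁ → t₁ < t₂ →
    |∫ t in t₁..t₂, zetaArgS t| ≤ 2.067 + 0.059 * Real.log t₂

/-- **Trudgian 2016, Theorem 1** (*Improvements to Turing's method II*, Rocky Mountain J. Math.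
46): if `t₂ > t₁ > 10⁵` then `|∫_{t₁}^{t₂} S(t) dt| ≤ 1.698 + 0.183 log log t₂ + 0.049 log t₂`.
(`S = Literature.zetaArgS`; see `abs_integral_zetaArgS_le_turing` for the convention. This is the second
of the two references Platt–Trudgian 2021, §2 cite for Turing's method.)
[cite: Trudgian2016, Thm. 1] -/
def abs_integral_zetaArgS_le_trudgianII : Prop :=
  ∀ ⦃t₁ t₂ : ℝ⦄, (10 : ℝ) ^ 5 < t₁ → t₁ < t₂ →
    |∫ t in t₁..t₂, zetaArgS t| ≤
      1.698 + 0.183 * Real.log (Real.log t₂) + 0.049 * Real.log t₂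

/-- Turing's method with Trudgian's 2011 bound plugged in: for `168π < T`, `0 < h`, found zeros
`Z` in `(T, T + h]` on the critical line and
`2.067 + 0.059 log (T + h) + ∫_T^{T+h} (θ/π + 1) − Σ_{γ ∈ Z} (T + h − γ) < h (n + 1)`,
one has `N(T) ≤ n`. [cite: Trudgian2011, Thm. 2.2] -/
theorem zetaZeroCount_le_of_turing_trudgian (hTr : abs_integral_zetaArgS_le_trudgian)
    {T h : ℝ} {n : ℕ} (hT : 168 * π < T) (hh : 0 < h)
    (Z : Finset ℝ) (hZ : ∀ γ ∈ Z, riemannZeta (1 / 2 + γ * I) = 0 ∧ T < γ ∧ γ ≤ T + h)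
    (hnum : 2.067 + 0.059 * Real.log (T + h) + (∫ t in T..T + h, (riemannSiegelTheta t / π + 1))
        - ∑ γ ∈ Z, (T + h - γ) < h * (n + 1)) :
    zetaZeroCount T ≤ n := by
  have hT0 : 0 ≤ T := le_of_lt (lt_trans (by positivity) hT)
  have hS := (abs_le.1 (hTr hT (by linarith : T < T + h))).2
  exact zetaZeroCount_le_of_turing hT0 hh.le Z hZ hS (by linarith)

/-- **Turing's method with Trudgian's 2011 bound, assembled**: for `168π < T`, `0 < h`, the data
(i), (ii) of `RiemannHypothesisUpTo.of_turing` and the single inequality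
`2.067 + 0.059 log (T + h) + ∫_T^{T+h} (θ/π + 1) − Σ_j (T + h − s_{j+1}) < h (n + 1)` give
`RiemannHypothesisUpTo T ∧ N(T) = n ∧ N₀(T) = n`, conditionally only on the named fact
`abs_integral_zetaArgS_le_trudgian` (Trudgian 2011, Thm. 2.2). This is the exact shape of a
Platt–Trudgian-type verification: everything but the certified signs of `Z` and one explicit
real inequality is proved. [cite: Trudgian2011, Thm. 2.2] -/
theorem _root_.Literature.NumberTheory.DiophantineGeometry.RiemannHypothesisUpTo.of_turing_trudgian (hTr : abs_integral_zetaArgS_le_trudgian)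
    {T h : ℝ} {n m : ℕ} (hT : 168 * π < T) (hh : 0 < h)
    (t : Fin (n + 1) → ℝ) (ht : StrictMono t) (ht0 : 0 ≤ t 0) (htn : t (Fin.last n) ≤ T)
    (htsign : ∀ i : Fin n, hardyZ (t i.castSucc) * hardyZ (t i.succ) < 0)
    (s : Fin (m + 1) → ℝ) (hs : StrictMono s) (hs0 : T ≤ s 0) (hsm : s (Fin.last m) ≤ T + h)
    (hssign : ∀ i : Fin m, hardyZ (s i.castSucc) * hardyZ (s i.succ) < 0)
    (hnum : 2.067 + 0.059 * Real.log (T + h) + (∫ t in T..T + h, (riemannSiegelTheta t / π + 1))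
        - ∑ i : Fin m, (T + h - s i.succ) < h * (n + 1)) :
    DiophantineGeometry.RiemannHypothesisUpTo T ∧ zetaZeroCount T = n ∧ criticalZeroCount T = n :=
  DiophantineGeometry.RiemannHypothesisUpTo.of_turing hh.le t ht ht0 htn htsign s hs hs0 hsm hssign
    (abs_le.1 (hTr hT (by linarith : T < T + h))).2 hnum

/-! ### `N(T) → ∞` from zeros on the critical line -/

/-- **`N(T) → ∞` from infinitely many zeros on the critical line.** If `{t : ℝ | ζ(1/2 + it) = 0}`
is infinite — verbatim the named fact `Literature.NumberTheory.LFunctions.hardy_infinite_zeros_on_critical_line`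
(`RHWave0.lean`, Hardy 1914), taken here as a hypothesis so that this file need not import it —
then `N(T) → ∞` as `T → ∞`, i.e. the named fact `Literature.NumberTheory.LFunctions.tendsto_zetaZeroCount_atTop` of
`ZetaZeros.lean` holds. Proof: the zero set is symmetric under `t ↦ -t` (`riemannZeta_conj`), so
infinitely many ordinates are positive; any `n` of them, all `≤ T`, give `n ≤ N₀(T) ≤ N(T)`
(`criticalZeroCount_add_card_le`, `criticalZeroCount_le`), and `N` is monotone
(`zetaZeroCount_mono`). [cite: Hardy1914] -/
theorem tendsto_zetaZeroCount_atTop_of_infinite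
    (h : {t : ℝ | riemannZeta (1 / 2 + t * I) = 0}.Infinite) : tendsto_zetaZeroCount_atTop := by
  set S : Set ℝ := {t : ℝ | riemannZeta (1 / 2 + t * I) = 0} with hS
  set P : Set ℝ := {t : ℝ | riemannZeta (1 / 2 + t * I) = 0 ∧ 0 < t} with hP
  -- infinitely many positive ordinates, by the symmetry `t ↦ -t`
  have hPinf : P.Infinite := by
    by_contra hfin
    rw [Set.not_infinite] at hfin
    refine h ((((hfin.image fun t ↦ -t).union (Set.finite_singleton 0)).union hfin).subset ?_)
    intro t ht
    have ht' : riemannZeta (1 / 2 + t * I) = 0 := ht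
    rcases lt_trichotomy t 0 with hlt | rfl | hgt
    · refine Or.inl (Or.inl ⟨-t, ⟨?_, by linarith⟩, by simp⟩)
      have hc : (1 / 2 + ((-t : ℝ) : ℂ) * I) = starRingEnd ℂ (1 / 2 + (t : ℂ) * I) := by
        apply Complex.ext <;> simp
      show riemannZeta (1 / 2 + ((-t : ℝ) : ℂ) * I) = 0
      rw [hc, riemannZeta_conj, ht', map_zero]
    · exact Or.inl (Or.inr rfl)
    · exact Or.inr ⟨ht', hgt⟩
  show Filter.Tendsto zetaZeroCount Filter.atTop Filter.atTop
  refine zetaZeroCount_mono.tendsto_atTop_atTop fun n ↦ ?_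
  obtain ⟨F, hF, hcard⟩ := hPinf.exists_subset_card_eq n
  have hFP : ∀ γ ∈ F, riemannZeta (1 / 2 + γ * I) = 0 ∧ 0 < γ := fun γ hγ ↦ hF (by simpa using hγ)
  -- all of them lie below `T := Σ γ`
  set T : ℝ := ∑ γ ∈ F, γ with hT
  have hT0 : 0 ≤ T := Finset.sum_nonneg fun γ hγ ↦ (hFP γ hγ).2.le
  have hle : ∀ γ ∈ F, γ ≤ T := fun γ hγ ↦
    Finset.single_le_sum (f := fun γ : ℝ ↦ γ) (fun γ' hγ' ↦ (hFP γ' hγ').2.le) hγ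
  have h1 := criticalZeroCount_add_card_le le_rfl hT0 F
    fun γ hγ ↦ ⟨(hFP γ hγ).1, (hFP γ hγ).2, hle γ hγ⟩
  have h2 := DiophantineGeometry.criticalZeroCount_le T
  exact ⟨T, by omega⟩

end Literature.NumberTheory.LFunctions

end
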